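import Summits.BirchSwinnertonDyer.Rank1Residual.Additive.PotSupersingularTameLocalH1Vanishing
import Summits.BirchSwinnertonDyer.Rank1Residual.Additive.PotSupersingularLocalH1Vanishing
import Summits.BirchSwinnertonDyer.Rank1Residual.Additive.PotSupersingularNotCotorsion
import Summits.BirchSwinnertonDyer.Rank1Residual.AdditivePotMult.TwistTransportLocal
import HarnessLib

/-!
# `H¹((ℚ_∞)_η, E)(p) = 0` on the cell `(G) ∧ ss` of O5 (modulo A254 only), hence on ALL of O5, and
# on the whole potentially supersingular additive locus `O5 ∪ O6` (row T-CG-W addendum A3, cell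
# `b2b-bsdres`, team n1011; seat n1011-p05 GEN 10)

HONEST FRAMING (cell `b2b-bsdres`, run/shared/lean/b2b/bsd-rank1-residual/, verbatim in every
file): the goal of the cell is to DELETE the COMBINATION-SHAPED residual classes of the
Birch–Swinnerton-Dyer formula for ALL analytic-rank `≤ 1` elliptic curves over `ℚ` — "full BSD
formula for every rank `≤ 1` curve in class `C`" assembled STRICTLY from published theorems — so
that the rank-`≤ 1` remainder becomes exactly the CONSTRUCTION-SHAPED classes, which are TYPED
(missing-input `Prop`s), NOT attempted. This is not "finishing BSD". Team n1011 / classes O5–O6 of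
RESIDUAL-MAP §I (potentially supersingular additive `p`): research route; TOOL theorems of Galois
cohomology; 0 definitions, 0 NEW named facts (inputs carried as hypotheses, never dropped: `hCG` =
A254 `CoatesGreenberg1996.H1_goodModelKernel_trivial` (⇐ A256); `hCD` =
`Greenberg1999.localH1_primaryTorsion_divisible_cyclotomic` (CD) ONLY for the O6 half of the
union); nothing booked, no mark moves, closes no pair.

## What

* §1 `exists_eq_smul_sub_of_pow_smul_eq_zero_of_subGss` / `eq_zero_of_pow_nsmul_eq_zero_of_subGss`
  — **`H¹((ℚ_∞)_η, E)(p) = 0` on `(G) ∧ ss` = `SubGss` (odd `p`), modulo A254 ONLY.** There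
  `E ≅ V^{(p*)}` with `V` GOOD SUPERSINGULAR at `p` (`exists_goodSS_twist_pStar_of_subGss`,
  `GssTwistDictionary`). On the subgroup `G' = (ker κ ⊓ Gal(ℚ̄/ℚ(√p*)))_v` of
  `G = (ker κ)_v` (index `∣ 2`, prime to `p`: `coprime_index_galRange`,
  `card_quotient_localSubgroup_dvd_index`) additive-p1's LOCAL twist isomorphism
  `Φ = twistLocalEquiv ∘ twistLocalIso⁻¹ : E(K̄_v) ≃+ V(K̄_v)` is `G'`-equivariant
  (`twistLocalEquiv_smul`, `twistLocalIso_smul`), so a torsion-valued continuous crossed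
  homomorphism `G → E(K̄_v)` becomes on `G'` a torsion-valued one for `V`, principal by F3b's
  local core `exists_eq_smul_sub_of_pow_smul_eq_zero_of_level` at `V`'s `ℚ_v`-rational minimal
  model (all `p`-power torsion of `V(K̄_v)` in its kernel of reduction:
  `mem_localKernelOfReduction_of_pow_nsmul_eq_zero`); transported back it is principal on `G'` for
  `E`; F3a v2's COPRIME-INDEX descent `Descent.exists_eq_smul_sub_of_coprime_of_level` finishes,
  and A2's dévissage `eq_zero_of_pow_nsmul_eq_zero_of_forall_cocycle` gives the local vanishing.
* §2 **`ClassO5.eq_zero_of_pow_nsmul_eq_zero (hCG) (hO : ClassO5 W p)`** — ALL of O5 at every odd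
  `p` (O5 = `SubGss ∨ SubTprime`; `(t′)` by A2's `eq_zero_of_pow_nsmul_eq_zero_of_subTprime{,_three}`),
  modulo A254 ONLY; and **`eq_zero_of_pow_nsmul_eq_zero_of_classO5_or_classO6 (hCG) (hCD)`** — the
  WHOLE potentially supersingular additive locus at every odd `p` (O6 by A1's
  `ClassO6.eq_zero_of_pow_nsmul_eq_zero`, which needs CD). This is the printed statement
  "`H¹(F_∞,w, E)(p) ≃ H¹(F_∞,w, D)` … `D = 0` if and only if `E` has potential supersingular
  reduction at `v`" ([CoGr] Props. 4.3/4.8 as quoted by Coates, LNM 1716 §3) on every additive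
  potentially supersingular `(E, p)`, `p` odd, as kernel theorems.

References: J. Coates, LNM 1716 §3 (proof of Lemma 3.5); R. Greenberg, LNM 1716 §2
[GreenbergLNM1716]; J. Coates, R. Greenberg, Invent. Math. 124 (1996) §4 Props. 4.3, 4.8, Cor. 3.2
[CoatesGreenberg1996]; J. H. Silverman, *AEC* X.5 Cor. 5.4 [SilvermanAEC2009]; skeleton
`cells/n1011/skel/T-CG-W.md`.
-/

noncomputable section

open scoped Classical NNReal

open WeierstrassCurve

universe u

namespace Summit.BirchSwinnertonDyer.Rank1Residual.Additive.GoodModelLine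

open NumberField IsDedekindDomain Field IsDedekindDomain.HeightOneSpectrum
  Literature.NumberTheory.GaloisRepresentations Literature.NumberTheory.EllipticCurves
  Summit.BirchSwinnertonDyer.Rank1Residual.X2.GreenbergVatsalReductionDatum
  Summit.BirchSwinnertonDyer.Rank1Residual.X2.GreenbergVatsalSelmerLink
  Summit.BirchSwinnertonDyer.Rank1Residual.GaloisImage
  Summit.BirchSwinnertonDyer.Rank1Residual.AdditivePotMult
  Summit.BirchSwinnertonDyer.Rank1Residual.AdditivePotMult.RamifiedOrdinaryLinePotMult
  Summit.BirchSwinnertonDyer.Rank1Residual.O5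
  Literature.NumberTheory.EllipticCurves.CoatesGreenberg1996
  Literature.NumberTheory.EllipticCurves.Greenberg1999
  Literature.NumberTheory.EllipticCurves.Rank1Residual

variable (W : WeierstrassCurve ℚ) [W.IsElliptic] [W.IsGloballyMinimal] (p : ℕ) [hp : Fact p.Prime]
  {v : HeightOneSpectrum (𝓞 ℚ)}

/-! ## §1 The cell `(G) ∧ ss`: twist transport on the quadratic level, coprime descent -/

/-- **Torsion-valued cocycles on `(ker κ)_v` are principal on the `(G) ∧ ss` cell**, modulo the
Coates–Greenberg record only: `E ≅ V^{(p*)}` with `V` good supersingular at `p`; on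
`G' = (ker κ ⊓ Gal(ℚ̄/ℚ(√p*)))_v` the local twist isomorphism `E(K̄_v) ≃+ V(K̄_v)` is equivariant,
so F3b's local core for `V`'s minimal model makes the transported cocycle principal on `G'`;
`[G : G'] ∣ 2` is prime to the odd `p`, and F3a v2's coprime-index descent concludes.
[cite: GreenbergLNM1716, §2 (potentially supersingular primes)] [cite: CoatesGreenberg1996, Cor. 3.2 and §4 Props. 4.3, 4.8 (through Coates, LNM 1716 §3)] [cite: SilvermanAEC2009, X.5 Cor. 5.4] -/
theorem exists_eq_smul_sub_of_pow_smul_eq_zero_of_subGss (hCG : H1_goodModelKernel_trivial.{0})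
    (hp2 : p ≠ 2) (hadd : Addv W p) (h : SubGss W p) (κ : ZpExtension ℚ p) (hκ : κ.IsCyclotomic)
    (hpv : ((p : ℕ) : 𝓞 ℚ) ∈ v.asIdeal)
    (F : contOneCocycles (discreteTopRep (localSubgroup κ.kerSubgroup (v.adicCompletion ℚ))
      (localPoints W (v.adicCompletion ℚ))))
    (hF : ∀ τ, ∃ k : ℕ, p ^ k • F.1 τ = 0) :
    ∃ a : localPoints W (v.adicCompletion ℚ),
      ∀ τ : localSubgroup κ.kerSubgroup (v.adicCompletion ℚ), F.1 τ = τ • a - a := by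
  obtain ⟨V, _, _, C₁, hC₁, hV⟩ := exists_goodSS_twist_pStar_of_subGss W p hp2 hadd h
  obtain ⟨C, hC⟩ := exists_variableChange_twist_of_model_twist W (pStar_ne_zero p) hC₁
  obtain ⟨K, _, _, h2, θ, hθ, hc⟩ := exists_numberField_sq_eq_pStar (p := p) hp2
  haveI : IsGalois ℚ K := isGalois_of_finrank_eq_two K h2
  haveI hKN : (galRange (K := ℚ) K).Normal := normal_galRange K h2 (sigmaQ_ne_one K h2 hθ hc)
  have hgood : V.HasGoodReductionAt v := V.hasGoodReductionAt_of_hasGoodReductionAtPrime v hpv hV.1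
  have hss : ¬ V.HasUnitRootAt v := fun h' ↦
    (V.hasUnitRootAt_iff_not_dvd_frobeniusTrace v hp.out hpv).1 h' hV.2
  -- compactness of `G = (ker κ)_v`
  haveI : CompactSpace (absoluteGaloisGroup (v.adicCompletion ℚ)) :=
    absoluteGaloisGroup_compactSpace (v.adicCompletion ℚ)
  have hGc : IsClosed (localSubgroup κ.kerSubgroup (v.adicCompletion ℚ) :
      Set (absoluteGaloisGroup (v.adicCompletion ℚ))) :=
    κ.isClosed_kerSubgroup.preimage (map_continuous (resGal (K := ℚ) (v.adicCompletion ℚ)))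
  haveI : CompactSpace (localSubgroup κ.kerSubgroup (v.adicCompletion ℚ)) :=
    isCompact_iff_compactSpace.mp hGc.isCompact
  -- the finite-index subgroup `N = G ∩ Gal(K̄_v/K_w)` of index prime to `p`
  have hcopK : (galRange (K := ℚ) K).index.Coprime p := coprime_index_galRange K h2 hθ hc p hp2
  haveI := finite_quotient_localSubgroup_of_index_coprime (v := v) p
    (localSubgroup κ.kerSubgroup (v.adicCompletion ℚ)) (galRange (K := ℚ) K) hp.out.one_lt.ne' hcopK
  refine Descent.exists_eq_smul_sub_of_coprime_of_level
    ((localSubgroup (galRange (K := ℚ) K) (v.adicCompletion ℚ)).subgroupOf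
      (localSubgroup κ.kerSubgroup (v.adicCompletion ℚ)))
    (coprime_card_quotient_localSubgroup_of_index_coprime (v := v) p _ _ hcopK)
    (fun F' hF' ↦ ?_) F hF
  -- the level `G' = (ker κ ⊓ galRange K)_v` and the equivariant local twist `Φ : E(K̄_v) ≃+ V(K̄_v)`
  have hle : localSubgroup (κ.kerSubgroup ⊓ galRange (K := ℚ) K) (v.adicCompletion ℚ) ≤
      localSubgroup κ.kerSubgroup (v.adicCompletion ℚ) := fun σ hσ ↦
    (mem_localSubgroup_iff _ _ σ).mpr (Subgroup.mem_inf.mp ((mem_localSubgroup_iff _ _ σ).mp hσ)).1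
  have hG'c : IsClosed (localSubgroup (κ.kerSubgroup ⊓ galRange (K := ℚ) K) (v.adicCompletion ℚ) :
      Set (absoluteGaloisGroup (v.adicCompletion ℚ))) :=
    (κ.isClosed_kerSubgroup.inter ((galRange (K := ℚ) K).isClosed_of_isOpen (isOpen_galRange K))).preimage
      (map_continuous (resGal (K := ℚ) (v.adicCompletion ℚ)))
  obtain ⟨Φ, hΦ⟩ : ∃ Φ : localPoints W (v.adicCompletion ℚ) ≃+ localPoints V (v.adicCompletion ℚ),
      ∀ (τ : localSubgroup (κ.kerSubgroup ⊓ galRange (K := ℚ) K) (v.adicCompletion ℚ))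
        (P : localPoints W (v.adicCompletion ℚ)),
        Φ ((τ : absoluteGaloisGroup (v.adicCompletion ℚ)) • P) =
          (τ : absoluteGaloisGroup (v.adicCompletion ℚ)) • Φ P := by
    refine ⟨(twistLocalIso (v.adicCompletion ℚ) hC).symm.trans
      (twistLocalEquiv V K hθ hc (closureEmb (K := ℚ) (v.adicCompletion ℚ))), fun τ P ↦ ?_⟩
    have h1 : (twistLocalIso (v.adicCompletion ℚ) hC).symm
        ((τ : absoluteGaloisGroup (v.adicCompletion ℚ)) • P) =
        (τ : absoluteGaloisGroup (v.adicCompletion ℚ)) • (twistLocalIso (v.adicCompletion ℚ) hC).symm P := by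
      apply (twistLocalIso (v.adicCompletion ℚ) hC).injective
      rw [AddEquiv.apply_symm_apply, twistLocalIso_smul, AddEquiv.apply_symm_apply]
    have h2 := twistLocalEquiv_smul V K hθ hc (closureEmb (K := ℚ) (v.adicCompletion ℚ))
      (H := κ.kerSubgroup ⊓ galRange (K := ℚ) K) inf_le_right τ
      ((twistLocalIso (v.adicCompletion ℚ) hC).symm P)
    rw [AddEquiv.trans_apply, AddEquiv.trans_apply, h1]
    exact h2
  -- `V`'s `ℚ_v`-rational minimal model: good, supersingular, fixed by every `σ`
  have hV₀ : (((V.baseChange (v.adicCompletion ℚ)).exists_isMinimal (v.adicCompletionIntegers ℚ)).choose.map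
        (algebraMap (v.adicCompletion ℚ) (AlgebraicClosure (v.adicCompletion ℚ)))) •
      (V.baseChange (v.adicCompletion ℚ)).baseChange (AlgebraicClosure (v.adicCompletion ℚ)) =
      (V.localSpectralModel v).baseChange (AlgebraicClosure (v.adicCompletion ℚ)) := by
    rw [← VariableChange.baseChange_smul_eq, V.smul_baseChange_eq_map_localMinimalIntegralModel v,
      V.localSpectralModel_baseChange v]
  have htorsV : ∀ P : localPoints V (v.adicCompletion ℚ), (∃ k : ℕ, p ^ k • P = 0) →
      Affine.Point.congrEquiv hV₀ (VariableChange.pointEquiv _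
        (((V.baseChange (v.adicCompletion ℚ)).exists_isMinimal (v.adicCompletionIntegers ℚ)).choose.map
          (algebraMap (v.adicCompletion ℚ) (AlgebraicClosure (v.adicCompletion ℚ))))
        (Affine.Point.congrEquiv (baseChange_baseChange_adicCompletion V v).symm P)) ∈
        kernelOfReduction (V.localSpectralModel v) (Valuation.integer.integers v.spectralValuation) := by
    rintro P ⟨k, hk⟩
    have hmem := mem_localKernelOfReduction_of_pow_nsmul_eq_zero p V hpv hgood hss hk
    rw [localKernelOfReduction, AddSubgroup.mem_comap] at hmem
    change V.localPointsEquivSpectralModel v P ∈ _ at hmem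
    rwa [localPointsEquivSpectralModel_eq_transport V v P hV₀] at hmem
  have hVC : ∀ σ ∈ localSubgroup (κ.kerSubgroup ⊓ galRange (K := ℚ) K) (v.adicCompletion ℚ),
      (((V.baseChange (v.adicCompletion ℚ)).exists_isMinimal (v.adicCompletionIntegers ℚ)).choose.map
        (algebraMap (v.adicCompletion ℚ) (AlgebraicClosure (v.adicCompletion ℚ)))).map
        ((absoluteGaloisGroup.toAlgEquiv (v.adicCompletion ℚ) σ :
          AlgebraicClosure (v.adicCompletion ℚ) ≃ₐ[v.adicCompletion ℚ]
            AlgebraicClosure (v.adicCompletion ℚ)) :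
          AlgebraicClosure (v.adicCompletion ℚ) →+* AlgebraicClosure (v.adicCompletion ℚ)) =
      ((V.baseChange (v.adicCompletion ℚ)).exists_isMinimal (v.adicCompletionIntegers ℚ)).choose.map
        (algebraMap (v.adicCompletion ℚ) (AlgebraicClosure (v.adicCompletion ℚ))) := by
    intro σ _
    rw [VariableChange.map_map]
    congr 1
    ext x
    exact AlgEquiv.commutes _ x
  -- the transported cocycle `ψ = Φ ∘ F'|_{G'}` for `V`
  let ψ : contOneCocycles (discreteTopRep
      (localSubgroup (κ.kerSubgroup ⊓ galRange (K := ℚ) K) (v.adicCompletion ℚ))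
      (localPoints V (v.adicCompletion ℚ))) :=
    contOneCocycles.pullback (subgroupInclusion hle)
      (resHomOfEquivariant (subgroupInclusion hle) Φ.toAddMonoidHom fun τ P ↦ by
        rw [Subgroup.smul_def, Subgroup.smul_def, subgroupInclusion_apply_coe]
        exact hΦ τ P) F'
  have hψ : ∀ τ, ψ.1 τ = Φ (F'.1 (Subgroup.inclusion hle τ)) := fun _ ↦ rfl
  have hψtors : ∀ τ, ∃ k : ℕ, p ^ k • ψ.1 τ = 0 := fun τ ↦ by
    obtain ⟨k, hk⟩ := hF' (Subgroup.inclusion hle τ)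
    exact ⟨k, by rw [hψ, ← map_nsmul, hk, map_zero]⟩
  obtain ⟨b, hb⟩ := exists_eq_smul_sub_of_pow_smul_eq_zero_of_level V p (coe_spectralValuation v) hV₀
    (V.isUnit_Δ_localSpectralModel hgood) htorsV hCG κ hκ hpv
    (localSubgroup (κ.kerSubgroup ⊓ galRange (K := ℚ) K) (v.adicCompletion ℚ)) hG'c
    (fun σ hσ ↦ (mem_localSubgroup_iff _ _ σ).mpr
      (Subgroup.mem_inf.mp ((mem_localSubgroup_iff _ _ σ).mp hσ)).1) hVC ψ hψtors
  -- transport back along `Φ⁻¹`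
  refine ⟨Φ.symm b, fun g hg ↦ ?_⟩
  have hg' : (g : absoluteGaloisGroup (v.adicCompletion ℚ)) ∈
      localSubgroup (κ.kerSubgroup ⊓ galRange (K := ℚ) K) (v.adicCompletion ℚ) :=
    (mem_localSubgroup_iff _ _ _).mpr (Subgroup.mem_inf.mpr
      ⟨(mem_localSubgroup_iff _ _ _).mp g.2,
        (mem_localSubgroup_iff _ _ _).mp (Subgroup.mem_subgroupOf.mp hg)⟩)
  have hbg := hb ⟨g, hg'⟩
  rw [hψ] at hbg
  have hincl : Subgroup.inclusion hle ⟨(g : absoluteGaloisGroup (v.adicCompletion ℚ)), hg'⟩ = g := rfl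
  rw [hincl, Subgroup.smul_def] at hbg
  -- `hbg : Φ (F' g) = g • b - b`; `key : Φ (g • Φ⁻¹ b) = g • b`
  have key := hΦ ⟨(g : absoluteGaloisGroup (v.adicCompletion ℚ)), hg'⟩ (Φ.symm b)
  rw [AddEquiv.apply_symm_apply] at key
  apply Φ.injective
  rw [map_sub, AddEquiv.apply_symm_apply, Subgroup.smul_def, hbg]
  exact congrArg (· - b) key.symm

/-- **`H¹((ℚ_∞)_η, E(K̄_v))(p) = 0` on the cell `(G) ∧ ss` of O5, modulo A254 ONLY** (odd `p`,
`Addv W p ∧ SubGss W p`: `e = 2`, `E ≅ V^{(p*)}` with `V` good supersingular at `p`): the group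
`H¹((ker κ)_v, E(K̄_v))` has no non-zero class killed by a power of `p` (A2's dévissage
`eq_zero_of_pow_nsmul_eq_zero_of_forall_cocycle` on `exists_eq_smul_sub_of_pow_smul_eq_zero_of_subGss`).
[cite: CoatesGreenberg1996, §4 Props. 4.3, 4.8 (through Coates, LNM 1716 §3) and Cor. 3.2] [cite: GreenbergLNM1716, §2] -/
theorem eq_zero_of_pow_nsmul_eq_zero_of_subGss (hCG : H1_goodModelKernel_trivial.{0})
    (hp2 : p ≠ 2) (hadd : Addv W p) (h : SubGss W p) (κ : ZpExtension ℚ p) (hκ : κ.IsCyclotomic)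
    (hpv : ((p : ℕ) : 𝓞 ℚ) ∈ v.asIdeal)
    (z : discreteH1 (localSubgroup κ.kerSubgroup (v.adicCompletion ℚ))
      (localPoints W (v.adicCompletion ℚ))) (k : ℕ) (hz : p ^ k • z = 0) : z = 0 :=
  eq_zero_of_pow_nsmul_eq_zero_of_forall_cocycle W p κ
    (fun F hF ↦ exists_eq_smul_sub_of_pow_smul_eq_zero_of_subGss W p hCG hp2 hadd h κ hκ hpv F hF)
    z k hz

/-! ## §2 All of O5 (modulo A254 only); the whole potentially supersingular additive locus -/

/-- **`H¹((ℚ_∞)_η, E)(p) = 0` on ALL of class O5, modulo A254 ONLY** (`ClassO5 W p` =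
`p ≠ 2 ∧ Addv W p ∧ (SubGss W p ∨ SubTprime W p)`, cc-typer-5's predicate): `(G) ∧ ss` by §1,
`(t′)` by A2's `eq_zero_of_pow_nsmul_eq_zero_of_subTprime` (`p ≥ 5`) /
`eq_zero_of_pow_nsmul_eq_zero_of_subTprime_three` (`p = 3`). The printed [CoGr] Props. 4.3/4.8
statement ("`D = 0` iff potentially supersingular", Coates LNM 1716 §3) on the TAME potentially
supersingular additive locus, CD-free. Negative / structural local statement; closes no pair; O5 OPEN.
[cite: CoatesGreenberg1996, §4 Props. 4.3, 4.8 (through Coates, LNM 1716 §3) and Cor. 3.2] [cite: GreenbergLNM1716, §2] -/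
theorem ClassO5.eq_zero_of_pow_nsmul_eq_zero (hCG : H1_goodModelKernel_trivial.{0})
    (hO : ClassO5 W p) (κ : ZpExtension ℚ p) (hκ : κ.IsCyclotomic)
    (hpv : ((p : ℕ) : 𝓞 ℚ) ∈ v.asIdeal)
    (z : discreteH1 (localSubgroup κ.kerSubgroup (v.adicCompletion ℚ))
      (localPoints W (v.adicCompletion ℚ))) (k : ℕ) (hz : p ^ k • z = 0) : z = 0 := by
  rcases hO.2.2 with h | h
  · exact eq_zero_of_pow_nsmul_eq_zero_of_subGss W p hCG hO.1 hO.2.1 h κ hκ hpv z k hz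
  · by_cases hp5 : 5 ≤ p
    · exact eq_zero_of_pow_nsmul_eq_zero_of_subTprime W p hCG hp5 hO.2.1 h κ hκ hpv z k hz
    · -- the odd prime `p < 5` is `3`
      have hp3 : p = 3 := by
        have h2 := hp.out.two_le
        have hlt : p < 5 := not_le.mp hp5
        interval_cases p
        · exact absurd rfl hO.1
        · rfl
        · exact absurd hp.out (by decide)
      subst hp3
      exact eq_zero_of_pow_nsmul_eq_zero_of_subTprime_three W hCG hO.2.1 h κ hκ hpv z k hz

/-- **`H¹((ℚ_∞)_η, E)(p) = 0` on the WHOLE potentially supersingular additive locus at every odd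
`p`** (`ClassO5 ∨ ClassO6` = tame ∪ wild; cc-typer-5's `addv_odd_cells`: the odd additive locus is
`(M) ∨ (G-ord) ∨ O5 ∨ O6`, and (M)/(G-ord) are NOT potentially supersingular), modulo A254 (`hCG`)
and — for the O6 half only — CD (`hCD`): O5 by `ClassO5.eq_zero_of_pow_nsmul_eq_zero` (CD-free),
O6 by A1's `ClassO6.eq_zero_of_pow_nsmul_eq_zero`. The literal Coates–Greenberg statement
"`H¹(F_∞,w, E)(p) = 0` when `E` has potential supersingular reduction at `v`" (Props. 4.3/4.8 via
Coates, LNM 1716 §3) for additive `E/ℚ` at odd `p`, as a kernel theorem. Closes no pair; O5/O6 OPEN.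
[cite: CoatesGreenberg1996, §4 Props. 4.3, 4.8 (through Coates, LNM 1716 §3, proof of Lemma 3.5)] [cite: GreenbergLNM1716, §2 and §4 (Lemma 4.5 ¶)] -/
theorem eq_zero_of_pow_nsmul_eq_zero_of_classO5_or_classO6 (hCG : H1_goodModelKernel_trivial.{0})
    (hCD : localH1_primaryTorsion_divisible_cyclotomic.{0}) (hO : ClassO5 W p ∨ ClassO6 W p)
    (κ : ZpExtension ℚ p) (hκ : κ.IsCyclotomic) (hpv : ((p : ℕ) : 𝓞 ℚ) ∈ v.asIdeal)
    (z : discreteH1 (localSubgroup κ.kerSubgroup (v.adicCompletion ℚ))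
      (localPoints W (v.adicCompletion ℚ))) (k : ℕ) (hz : p ^ k • z = 0) : z = 0 := by
  rcases hO with h | h
  · exact ClassO5.eq_zero_of_pow_nsmul_eq_zero W p hCG h κ hκ hpv z k hz
  · obtain rfl : p = 3 := h.p_eq_three
    exact ClassO6.eq_zero_of_pow_nsmul_eq_zero W hCG hCD h κ hκ hpv z k hz

end Summit.BirchSwinnertonDyer.Rank1Residual.Additive.GoodModelLine

end
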